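import Literature.AlgebraicGeometry.Frobenioids.PerfectionPreSteps
import HarnessLib

/-!
# Frobenioids I, Prop. 3.2 (ii) for `C^pf`, the clause "isomorphism": a perfected morphism is an
# isomorphism iff a cofinal collection of the arrows of `C` that determine it consists of isomorphisms

Mochizuki, *The geometry of Frobenioids I: the general theory*, Kyushu J. Math. **62** (2008)
293–400, Proposition 3.2 (ii) p. 59 [cite: MochizukiFrdI2008, Prop. 3.2 (ii) p.59]: an arrow of `C^pf` is
an isomorphism (resp. …) "if and only if a cofinal collection of the system of arrows of `C` that determine
this arrow of `C^pf` [cf. Definition 3.1, (ii)] is so".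

PROOF-ONLY companion of the `C^pf` chain.  We prove the ISOMORPHISM clause in exactly this cofinal form
(`isIso_mk_iff_cofinal`): `[r]` is an isomorphism of `C^pf` iff the transports `r_L` of the representative
`r` are isomorphisms of `C` for all levels `L` above some level.  Ingredients: transport preserves
isomorphisms (`isIso_lift`); an inverse class `[s]` of `[r]` yields, at one common level `N = (p, q)` with
`r_N : A^{(p)} → B^{(q)}`, `s_N : B^{(q)} → A^{(p)}`, that `r_N ≫ s_N` and `s_N ≫ r_N` are isomorphisms
(the units of `C^pf` transported; Prop. 1.10 (i) functoriality of transport), whence `r_N` is an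
isomorphism.  Piece of row FrdI:Prop3.2(iii)-frobenioid / Prop. 3.2 (ii) of the cell (seat abc-iut-L1-d9).

DISCLOSURE.  Only `hF : IsFrobenioid F` is assumed (print's standing hypothesis "`C` of Frobenius-isotropic
type", Def. 3.1 (iii) p. 56, is not needed here).
-/

namespace Literature.AlgebraicGeometry.Frobenioids

namespace PreFrobenioid

namespace Perfection

open CategoryTheory Opposite

universe w v v' u u'

variable {D : Type u} [Category.{v} D] {Φ : Dᵒᵖ ⥤ CommMonCat.{w}}
  {C : Type u'} [Category.{v'} C] {F : C ⥤ ElemFrobenioid Φ} {hF : IsFrobenioid F}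
  {X Y : Perfection hF}

/-- Every arrow of `C^pf` has a representative. [cite: MochizukiFrdI2008, Def. 3.1 (iii) p.57] -/
theorem exists_rep (f : X ⟶ Y) : ∃ r : Rep X Y, (Hom.mk r : X ⟶ Y) = f := Hom.mk_surjective f

/-! ### Transport preserves isomorphisms -/

/-- Transport of an isomorphism of `C` is an isomorphism (its inverse is the transport of the inverse).
[cite: MochizukiFrdI2008, Prop. 1.10 (i) p.34] -/
theorem isIso_lift (L L' : Level X Y) (h : L.LE L') (φ : L.HomAt) (hφ : IsIso φ) :
    IsIso (Level.lift L L' h φ) := by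
  haveI := hφ
  let M : Level Y X := ⟨L.b, L.a, L.eq.symm⟩
  let M' : Level Y X := ⟨L'.b, L'.a, L'.eq.symm⟩
  have h' : M.LE M' := ⟨h.2, h.1⟩
  refine ⟨⟨Level.lift M M' h' (inv φ), ?_, ?_⟩⟩
  · have e := (liftLevel_comp hF φ (inv φ) h.1 h.2 h.1 (Level.degFr_eq L L' h) (Level.degFr_eq M M' h')).symm
    change Level.lift L L' h φ ≫ Level.lift M M' h' (inv φ) = _ at e
    rw [e, IsIso.hom_inv_id, liftLevel_id]
  · have e := (liftLevel_comp hF (inv φ) φ h.2 h.1 h.2 (Level.degFr_eq M M' h') (Level.degFr_eq L L' h)).symm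
    change Level.lift M M' h' (inv φ) ≫ Level.lift L L' h φ = _ at e
    rw [e, IsIso.inv_hom_id, liftLevel_id]

/-- If some transport of `r` is an isomorphism then so are all higher ones, and `[r]` is an isomorphism.
[cite: MochizukiFrdI2008, Prop. 3.2 (ii) p.59] -/
theorem isIso_mk_of_isIso_lift (r : Rep X Y) (L : Level X Y) (h : r.L.LE L)
    (hr : IsIso (Level.lift r.L L h r.hom)) : IsIso (X := X) (Y := Y) (Hom.mk r) := by
  rw [← Hom.mk_lift r L h]
  exact isIso_mk_of_isIso _ hr

/-! ### An arrow with a two-sided "inverse up to isomorphism" is an isomorphism -/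

/-- If `R ≫ S` and `S ≫ R` are isomorphisms then `R` is an isomorphism.
[cite: MochizukiFrdI2008, Prop. 3.2 (ii) p.59] -/
theorem isIso_of_isIso_comp_comp {P Q : C} (R : P ⟶ Q) (S : Q ⟶ P) (h₁ : IsIso (R ≫ S))
    (h₂ : IsIso (S ≫ R)) : IsIso R := by
  haveI := h₁
  haveI := h₂
  have hv : R ≫ (S ≫ inv (R ≫ S)) = 𝟙 P := by rw [← Category.assoc, IsIso.hom_inv_id]
  have hu : (inv (S ≫ R) ≫ S) ≫ R = 𝟙 Q := by rw [Category.assoc, IsIso.inv_hom_id]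
  have huv : inv (S ≫ R) ≫ S = S ≫ inv (R ≫ S) := by
    rw [← Category.comp_id (inv (S ≫ R) ≫ S), ← hv, ← Category.assoc, hu, Category.id_comp]
  exact ⟨⟨S ≫ inv (R ≫ S), hv, huv ▸ hu⟩⟩

/-! ### The isomorphism clause of Prop. 3.2 (ii) -/

/-- An isomorphism of `C^pf` has a representative level above which all transports are isomorphisms of `C`.
[cite: MochizukiFrdI2008, Prop. 3.2 (ii) p.59] -/
theorem exists_isIso_lift_of_isIso (r : Rep X Y) (hr : IsIso (X := X) (Y := Y) (Hom.mk r)) :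
    ∃ (N : Level X Y) (hN : r.L.LE N), IsIso (Level.lift r.L N hN r.hom) := by
  haveI := hr
  obtain ⟨s, hs⟩ := exists_rep (inv (Hom.mk r : X ⟶ Y))
  have e₁ : (Hom.mk r ≫ Hom.mk s : X ⟶ X) = 𝟙 X := by rw [hs, IsIso.hom_inv_id]
  have e₂ : (Hom.mk s ≫ Hom.mk r : Y ⟶ Y) = 𝟙 Y := by rw [hs, IsIso.inv_hom_id]
  -- a common level `P = (p, q)` for `r` with the swapped level `Q = (q, p)` for `s`
  let p : ℕ+ := r.L.a * s.L.b * s.L.a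
  let q : ℕ+ := r.L.b * s.L.b * s.L.a
  have ePQ : X.idx * p = Y.idx * q := by
    change X.idx * (r.L.a * s.L.b * s.L.a) = Y.idx * (r.L.b * s.L.b * s.L.a)
    rw [← mul_assoc, ← mul_assoc, ← mul_assoc, ← mul_assoc, r.L.eq]
  let T : Level₃ X Y X := ⟨p, q, p, ePQ, ePQ.symm⟩
  let T' : Level₃ Y X Y := ⟨q, p, q, ePQ.symm, ePQ⟩
  have hrP : r.L.LE T.fst :=
    ⟨Dvd.intro (s.L.b * s.L.a) (mul_assoc _ _ _).symm, Dvd.intro (s.L.b * s.L.a) (mul_assoc _ _ _).symm⟩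
  have hsQ : s.L.LE T.snd :=
    ⟨Dvd.intro (r.L.b * s.L.b) (show s.L.a * (r.L.b * s.L.b) = r.L.b * s.L.b * s.L.a by ac_rfl),
      Dvd.intro (r.L.a * s.L.a) (show s.L.b * (r.L.a * s.L.a) = r.L.a * s.L.b * s.L.a by ac_rfl)⟩
  have hsQ' : s.L.LE T'.fst := hsQ
  have hrP' : r.L.LE T'.snd := hrP
  -- the two units, at the triple levels `T = (p, q, p)` and `T' = (q, p, q)`
  have u₁ : Hom.mk ⟨T.out, compAt T r s hrP hsQ⟩ = Hom.mk (Rep.id X) := by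
    rw [mk_compAt, ← id_eq_mk]; exact e₁
  have u₂ : Hom.mk ⟨T'.out, compAt T' s r hsQ' hrP'⟩ = Hom.mk (Rep.id Y) := by
    rw [mk_compAt, ← id_eq_mk]; exact e₂
  obtain ⟨M, hM₁, hM₂, eM⟩ := Hom.mk_eq_mk.mp u₁
  obtain ⟨M', hM₁', hM₂', eM'⟩ := Hom.mk_eq_mk.mp u₂
  -- one scaling factor for both
  let t : ℕ+ := M.a * M.b * (M'.a * M'.b)
  let N : Level X Y := ⟨p * t, q * t, by rw [← mul_assoc, ePQ, mul_assoc]⟩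
  let N' : Level Y X := ⟨q * t, p * t, by rw [← mul_assoc, ← ePQ, mul_assoc]⟩
  let L : Level X X := ⟨p * t, p * t, rfl⟩
  let L' : Level Y Y := ⟨q * t, q * t, rfl⟩
  have kP : T.fst.LE N := ⟨dvd_mul_right _ _, dvd_mul_right _ _⟩
  have kQ : T.snd.LE N' := ⟨dvd_mul_right _ _, dvd_mul_right _ _⟩
  have hL : T.out.LE L := ⟨dvd_mul_right _ _, dvd_mul_right _ _⟩
  have hL' : T'.out.LE L' := ⟨dvd_mul_right _ _, dvd_mul_right _ _⟩
  have tMa : M.a ∣ t :=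
    Dvd.intro _ (show M.a * (M.b * (M'.a * M'.b)) = M.a * M.b * (M'.a * M'.b) by ac_rfl)
  have tMb : M.b ∣ t :=
    Dvd.intro _ (show M.b * (M.a * (M'.a * M'.b)) = M.a * M.b * (M'.a * M'.b) by ac_rfl)
  have tMa' : M'.a ∣ t :=
    Dvd.intro _ (show M'.a * (M.a * M.b * M'.b) = M.a * M.b * (M'.a * M'.b) by ac_rfl)
  have tMb' : M'.b ∣ t :=
    Dvd.intro _ (show M'.b * (M.a * M.b * M'.a) = M.a * M.b * (M'.a * M'.b) by ac_rfl)
  have hML : M.LE L := ⟨tMa.trans (dvd_mul_left _ _), tMb.trans (dvd_mul_left _ _)⟩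
  have hML' : M'.LE L' := ⟨tMa'.trans (dvd_mul_left _ _), tMb'.trans (dvd_mul_left _ _)⟩
  have h1L : (Rep.id X).L.LE L := ⟨one_dvd _, one_dvd _⟩
  have h1L' : (Rep.id Y).L.LE L' := ⟨one_dvd _, one_dvd _⟩
  have E₁ := lift_eq_lift_of_le hM₁ hM₂ eM hML hL h1L
  have E₂ := lift_eq_lift_of_le hM₁' hM₂' eM' hML' hL' h1L'
  -- rewrite the transported units as composites of the transports `R`, `S` at level `N`
  change Level.lift T.out L hL (compAt T r s hrP hsQ) = Level.lift (Rep.id X).L L h1L (𝟙 _) at E₁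
  change Level.lift T'.out L' hL' (compAt T' s r hsQ' hrP') = Level.lift (Rep.id Y).L L' h1L' (𝟙 _) at E₂
  unfold compAt at E₁ E₂
  have c₁ := liftLevel_comp hF (Level.lift r.L T.fst hrP r.hom) (Level.lift s.L T.snd hsQ s.hom) hL.1 kP.2 hL.2
    (Level.degFr_eq T.fst N kP) (Level.degFr_eq T.snd N' kQ)
  have c₂ := liftLevel_comp hF (Level.lift s.L T.snd hsQ s.hom) (Level.lift r.L T.fst hrP r.hom) hL'.1 kP.1
    hL'.2 (Level.degFr_eq T.snd N' kQ) (Level.degFr_eq T.fst N kP)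
  change Level.lift T.out L hL (Level.lift r.L T.fst hrP r.hom ≫ Level.lift s.L T.snd hsQ s.hom) =
    Level.lift T.fst N kP (Level.lift r.L T.fst hrP r.hom) ≫ Level.lift T.snd N' kQ (Level.lift s.L T.snd hsQ s.hom)
    at c₁
  change Level.lift T'.out L' hL' (Level.lift s.L T.snd hsQ s.hom ≫ Level.lift r.L T.fst hrP r.hom) =
    Level.lift T.snd N' kQ (Level.lift s.L T.snd hsQ s.hom) ≫ Level.lift T.fst N kP (Level.lift r.L T.fst hrP r.hom)
    at c₂
  rw [c₁, Level.lift_trans, Level.lift_trans] at E₁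
  rw [c₂, Level.lift_trans, Level.lift_trans] at E₂
  have i₁ : IsIso (Level.lift r.L N (hrP.trans kP) r.hom ≫ Level.lift s.L N' (hsQ.trans kQ) s.hom) := by
    rw [E₁]; exact isIso_lift _ _ h1L _ (by exact IsIso.id (frobPow hF X.obj 1))
  have i₂ : IsIso (Level.lift s.L N' (hsQ.trans kQ) s.hom ≫ Level.lift r.L N (hrP.trans kP) r.hom) := by
    rw [E₂]; exact isIso_lift _ _ h1L' _ (by exact IsIso.id (frobPow hF Y.obj 1))
  exact ⟨N, hrP.trans kP, isIso_of_isIso_comp_comp _ _ i₁ i₂⟩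

/-- **Prop. 3.2 (ii), the clause "isomorphism", for `C^pf` (cofinal form, as printed)**: `[r]` is an
isomorphism of `C^pf` iff the transports of `r` to all levels above some level are isomorphisms of `C`.
[cite: MochizukiFrdI2008, Prop. 3.2 (ii) p.59] -/
theorem isIso_mk_iff_cofinal (r : Rep X Y) :
    IsIso (X := X) (Y := Y) (Hom.mk r) ↔
      ∃ (N : Level X Y) (hN : r.L.LE N), ∀ (L : Level X Y) (hL : N.LE L),
        IsIso (Level.lift r.L L (hN.trans hL) r.hom) := by
  constructor
  · intro hr
    obtain ⟨N, hN, hI⟩ := exists_isIso_lift_of_isIso r hr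
    refine ⟨N, hN, fun L hL => ?_⟩
    rw [← Level.lift_trans hN hL]
    exact isIso_lift N L hL _ hI
  · rintro ⟨N, hN, h⟩
    exact isIso_mk_of_isIso_lift r N hN (h N N.le_rfl)

end Perfection

end PreFrobenioid

end Literature.AlgebraicGeometry.Frobenioids
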